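import Mathlib
import Summits.ResolutionOfSingularities.ResolutionOfSingularities.Theorems.HomologicalConductorPersistenceKC3LocalModelCa
import HarnessLib

/-!
# Crux `Persistence` (stmt-ResolutionOfSingularities-16484) — w44b K-C3, K2c (c1)-C: AFFINE → `T₀` TRANSPORT
# `b̄ ∈ caⁿ(k[x,y,z,t]/(f)) ⇒ b(x,y,z,t) ∈ caⁿ(T₀)`, `T₀ = loc O A` the route's literal first tower stage

Route `ResolutionOfSingularities/HomologicalConductor`, chain W4.4b (cell `res-hironaka`), crux `Persistence`
(stmt-ResolutionOfSingularities-16484), KILL CANDIDATE K-C3, KC3 SPELLING v1.1; res-L1-w44b-plan-1 RE-CUT 12:34:43Z (K2c (c0)+(c1) →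
res-type-010) and res-L1-w44b-lead-1 g2 13:44:48Z (K5 consumption (i)/(ii): the AFFINE fact-free K2-LOWER of res-L1-w44b-stub-2 /
res-type-011 is transported to `↥(loc 𝕆 𝔸)` «through e₀ + localisation + ring-equiv»). This file is that transport, once, in the
coercion-safe degree-level form: Iyengar–Takahashi Lemma 2.10 (1) into `k[X]_𝔪 ⧸ (f)·k[X]_𝔪`, `Ideal.quotEquivOfEq` to the span
form, then `e₀.symm` (`exists_kc3LocModelEquiv`, p533351) by `ringEquiv_apply_mem_cohomologyAnnihilatorOfDegree`.
res-type-010 (OFFER → TAKING-UNLESS-OBJECTED 2026-08-27T14:02:20Z). OURS; nothing here is a statement of the manuscript under review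
(Hironaka 2017); AI-written, weaker than expert review. Filed `--supports stmt-ResolutionOfSingularities-16484 --as helper`.

* `mk_algebraMap_mem_cohomologyAnnihilatorOfDegree_model_of_affine` — `b̄ ∈ caⁿ(k[X]/(f)) ⇒ (b/1)‾ ∈ caⁿ(k[X]_𝔪 ⧸ (f))`;
* **`mem_cohomologyAnnihilatorOfDegree_loc_of_affine`** — `b̄ ∈ caⁿ(k[X]/(f)) ⇒ ⟨b(x,y,z,t), _⟩ ∈ caⁿ(↥(loc O A))`;
* **`mem_cohomologyAnnihilator_loc_of_affine`** — the same for the full `ca = ⋃ₙ caⁿ`;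
* `mem_ca_loc_of_affine` — the route's set-valued form `b(x,y,z,t) ∈ NoZeno.Birth.ca (loc O A)`.
-/

noncomputable section

-- single-problem summit: the doubled namespace component `ResolutionOfSingularities` is forced
set_option linter.dupNamespace false

namespace Summit.ResolutionOfSingularities.ResolutionOfSingularities.Theorems.HomologicalConductor.KC3Upper

open MvPolynomial
open Literature.RingTheory.CohomologyAnnihilator
open Literature.AlgebraicGeometry.Resolution
open Summit.ResolutionOfSingularities.ResolutionOfSingularities.Theorems.NoZeno.Birth
open Summit.ResolutionOfSingularities.ResolutionOfSingularities.Theorems.HomologicalConductor.PersistenceKC3Tower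

/-! ## §1 Affine → the local model -/

section Model

variable (k : Type) [Field k]

/-- **Affine → local model**: `b̄ ∈ caⁿ(k[x,y,z,t]/(f)) ⇒ (b/1)‾ ∈ caⁿ(k[x,y,z,t]_𝔪 ⧸ (f))`, `f = X 0 * X 1 − X 2 ^ 3 − X 3 ^ 4`,
`𝔪` the origin (Iyengar–Takahashi Lemma 2.10 (1) for the localisation `k[X]_𝔪 ⧸ (f)·k[X]_𝔪` of `k[X]/(f)`, then
`Ideal.quotEquivOfEq` to the span form). [cite: IyengarTakahashi2014, Lemma 2.10 (1)] -/
theorem mk_algebraMap_mem_cohomologyAnnihilatorOfDegree_model_of_affine {b : MvPolynomial (Fin 4) k} {n : ℕ}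
    (h : Ideal.Quotient.mk (Ideal.span ({X 0 * X 1 - X 2 ^ 3 - X 3 ^ 4} : Set (MvPolynomial (Fin 4) k))) b ∈
      cohomologyAnnihilatorOfDegree (MvPolynomial (Fin 4) k ⧸
        Ideal.span ({X 0 * X 1 - X 2 ^ 3 - X 3 ^ 4} : Set (MvPolynomial (Fin 4) k))) n) :
    Ideal.Quotient.mk (Ideal.span {algebraMap (MvPolynomial (Fin 4) k) (OriginLocalization k 4)
        (X 0 * X 1 - X 2 ^ 3 - X 3 ^ 4)})
      (algebraMap (MvPolynomial (Fin 4) k) (OriginLocalization k 4) b) ∈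
      cohomologyAnnihilatorOfDegree (OriginLocalization k 4 ⧸
        Ideal.span {algebraMap (MvPolynomial (Fin 4) k) (OriginLocalization k 4) (X 0 * X 1 - X 2 ^ 3 - X 3 ^ 4)}) n := by
  set f : MvPolynomial (Fin 4) k := X 0 * X 1 - X 2 ^ 3 - X 3 ^ 4 with hf
  set S₄ := OriginLocalization k 4
  have hloc := map_cohomologyAnnihilatorOfDegree_le_of_isLocalization
    (Algebra.algebraMapSubmonoid (MvPolynomial (Fin 4) k ⧸ Ideal.span {f}) (originIdeal k 4).primeCompl)
    (S₄ ⧸ (Ideal.span {f}).map (algebraMap (MvPolynomial (Fin 4) k) S₄)) n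
    (Ideal.mem_map_of_mem _ h)
  rw [Ideal.Quotient.algebraMap_quotient_map_quotient] at hloc
  have hmap : (Ideal.span {f}).map (algebraMap (MvPolynomial (Fin 4) k) S₄) =
      Ideal.span {algebraMap (MvPolynomial (Fin 4) k) S₄ f} := by
    rw [Ideal.map_span, Set.image_singleton]
  have h2 := ringEquiv_apply_mem_cohomologyAnnihilatorOfDegree
    (R := S₄ ⧸ (Ideal.span {f}).map (algebraMap (MvPolynomial (Fin 4) k) S₄))
    (S := S₄ ⧸ Ideal.span {algebraMap (MvPolynomial (Fin 4) k) S₄ f}) (Ideal.quotEquivOfEq hmap) hloc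
  rwa [Ideal.quotEquivOfEq_mk] at h2

end Model

/-! ## §2 Affine → the route's literal `T₀ = loc O A` -/

section KC3

variable (k K : Type) [Field k] [Field K] [Algebra (MvPolynomial (Fin 3) k) K] [IsFractionRing (MvPolynomial (Fin 3) k) K]
  [Algebra k K] [IsScalarTower k (MvPolynomial (Fin 3) k) K]

/-- **AFFINE → `T₀` (OURS · w44b K2c (c1)-C).** `x, z, t` the coordinate functions of a fraction field `K` of `k[x,z,t]`,
`y = (z³+t⁴)x⁻¹`, `A = Algebra.adjoin k {x, z, t, y}`, `O ∋ k` a valuation ring of `K` centred at the origin of `A`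
(`O.valuation x, y, z, t < 1`). If the class of a polynomial `b` lies in `caⁿ(k[x,y,z,t]/(xy − z³ − t⁴))`, then the element
`b(x, y, z, t)` of `T₀ = loc O A` lies in `caⁿ(↥T₀)`. (Localisation + `e₀.symm`, `e₀ = exists_kc3LocModelEquiv`.)
[cite: IyengarTakahashi2014, Lemma 2.10 (1)] -/
theorem mem_cohomologyAnnihilatorOfDegree_loc_of_affine (O : ValuationSubring K) (hk : ∀ c : k, algebraMap k K c ∈ O)
    (hx : O.valuation (algebraMap (MvPolynomial (Fin 3) k) K (X 0)) < 1)
    (hy : O.valuation ((algebraMap (MvPolynomial (Fin 3) k) K (X 1) ^ 3 + algebraMap (MvPolynomial (Fin 3) k) K (X 2) ^ 4) *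
      (algebraMap (MvPolynomial (Fin 3) k) K (X 0))⁻¹) < 1)
    (hz : O.valuation (algebraMap (MvPolynomial (Fin 3) k) K (X 1)) < 1)
    (ht : O.valuation (algebraMap (MvPolynomial (Fin 3) k) K (X 2)) < 1)
    {b : MvPolynomial (Fin 4) k} {n : ℕ}
    (h : Ideal.Quotient.mk (Ideal.span ({X 0 * X 1 - X 2 ^ 3 - X 3 ^ 4} : Set (MvPolynomial (Fin 4) k))) b ∈
      cohomologyAnnihilatorOfDegree (MvPolynomial (Fin 4) k ⧸
        Ideal.span ({X 0 * X 1 - X 2 ^ 3 - X 3 ^ 4} : Set (MvPolynomial (Fin 4) k))) n)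
    (hb : MvPolynomial.aeval (R := k)
        (![algebraMap (MvPolynomial (Fin 3) k) K (X 0),
          (algebraMap (MvPolynomial (Fin 3) k) K (X 1) ^ 3 + algebraMap (MvPolynomial (Fin 3) k) K (X 2) ^ 4) *
            (algebraMap (MvPolynomial (Fin 3) k) K (X 0))⁻¹,
          algebraMap (MvPolynomial (Fin 3) k) K (X 1), algebraMap (MvPolynomial (Fin 3) k) K (X 2)] : Fin 4 → K) b ∈
      loc O (Algebra.adjoin k ({algebraMap (MvPolynomial (Fin 3) k) K (X 0), algebraMap (MvPolynomial (Fin 3) k) K (X 1),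
        algebraMap (MvPolynomial (Fin 3) k) K (X 2),
        (algebraMap (MvPolynomial (Fin 3) k) K (X 1) ^ 3 + algebraMap (MvPolynomial (Fin 3) k) K (X 2) ^ 4) *
          (algebraMap (MvPolynomial (Fin 3) k) K (X 0))⁻¹} : Set K))) :
    (⟨_, hb⟩ : ↥(loc O (Algebra.adjoin k ({algebraMap (MvPolynomial (Fin 3) k) K (X 0),
        algebraMap (MvPolynomial (Fin 3) k) K (X 1), algebraMap (MvPolynomial (Fin 3) k) K (X 2),
        (algebraMap (MvPolynomial (Fin 3) k) K (X 1) ^ 3 + algebraMap (MvPolynomial (Fin 3) k) K (X 2) ^ 4) *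
          (algebraMap (MvPolynomial (Fin 3) k) K (X 0))⁻¹} : Set K)))) ∈
      cohomologyAnnihilatorOfDegree ↥(loc O (Algebra.adjoin k ({algebraMap (MvPolynomial (Fin 3) k) K (X 0),
        algebraMap (MvPolynomial (Fin 3) k) K (X 1), algebraMap (MvPolynomial (Fin 3) k) K (X 2),
        (algebraMap (MvPolynomial (Fin 3) k) K (X 1) ^ 3 + algebraMap (MvPolynomial (Fin 3) k) K (X 2) ^ 4) *
          (algebraMap (MvPolynomial (Fin 3) k) K (X 0))⁻¹} : Set K))) n := by
  obtain ⟨e, he⟩ := exists_kc3LocModelEquiv k K O hk hx hy hz ht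
  have hmodel := mk_algebraMap_mem_cohomologyAnnihilatorOfDegree_model_of_affine k h
  have h4 := ringEquiv_apply_mem_cohomologyAnnihilatorOfDegree e.symm hmodel
  have hsymm : e.symm (Ideal.Quotient.mk _
      (algebraMap (MvPolynomial (Fin 4) k) (Localization.AtPrime (originIdeal k 4)) b)) = ⟨_, hb⟩ := by
    rw [RingEquiv.symm_apply_eq, he b hb]
  rw [hsymm] at h4
  exact h4

/-- **AFFINE → `T₀`, full `ca`**: `b̄ ∈ ca(k[x,y,z,t]/(xy − z³ − t⁴)) ⇒ b(x,y,z,t) ∈ ca(↥(loc O A))`. [cite: IyengarTakahashi2014, Lemma 2.10 (1)] -/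
theorem mem_cohomologyAnnihilator_loc_of_affine (O : ValuationSubring K) (hk : ∀ c : k, algebraMap k K c ∈ O)
    (hx : O.valuation (algebraMap (MvPolynomial (Fin 3) k) K (X 0)) < 1)
    (hy : O.valuation ((algebraMap (MvPolynomial (Fin 3) k) K (X 1) ^ 3 + algebraMap (MvPolynomial (Fin 3) k) K (X 2) ^ 4) *
      (algebraMap (MvPolynomial (Fin 3) k) K (X 0))⁻¹) < 1)
    (hz : O.valuation (algebraMap (MvPolynomial (Fin 3) k) K (X 1)) < 1)
    (ht : O.valuation (algebraMap (MvPolynomial (Fin 3) k) K (X 2)) < 1)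
    {b : MvPolynomial (Fin 4) k}
    (h : Ideal.Quotient.mk (Ideal.span ({X 0 * X 1 - X 2 ^ 3 - X 3 ^ 4} : Set (MvPolynomial (Fin 4) k))) b ∈
      cohomologyAnnihilator (MvPolynomial (Fin 4) k ⧸
        Ideal.span ({X 0 * X 1 - X 2 ^ 3 - X 3 ^ 4} : Set (MvPolynomial (Fin 4) k))))
    (hb : MvPolynomial.aeval (R := k)
        (![algebraMap (MvPolynomial (Fin 3) k) K (X 0),
          (algebraMap (MvPolynomial (Fin 3) k) K (X 1) ^ 3 + algebraMap (MvPolynomial (Fin 3) k) K (X 2) ^ 4) *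
            (algebraMap (MvPolynomial (Fin 3) k) K (X 0))⁻¹,
          algebraMap (MvPolynomial (Fin 3) k) K (X 1), algebraMap (MvPolynomial (Fin 3) k) K (X 2)] : Fin 4 → K) b ∈
      loc O (Algebra.adjoin k ({algebraMap (MvPolynomial (Fin 3) k) K (X 0), algebraMap (MvPolynomial (Fin 3) k) K (X 1),
        algebraMap (MvPolynomial (Fin 3) k) K (X 2),
        (algebraMap (MvPolynomial (Fin 3) k) K (X 1) ^ 3 + algebraMap (MvPolynomial (Fin 3) k) K (X 2) ^ 4) *
          (algebraMap (MvPolynomial (Fin 3) k) K (X 0))⁻¹} : Set K))) :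
    (⟨_, hb⟩ : ↥(loc O (Algebra.adjoin k ({algebraMap (MvPolynomial (Fin 3) k) K (X 0),
        algebraMap (MvPolynomial (Fin 3) k) K (X 1), algebraMap (MvPolynomial (Fin 3) k) K (X 2),
        (algebraMap (MvPolynomial (Fin 3) k) K (X 1) ^ 3 + algebraMap (MvPolynomial (Fin 3) k) K (X 2) ^ 4) *
          (algebraMap (MvPolynomial (Fin 3) k) K (X 0))⁻¹} : Set K)))) ∈
      cohomologyAnnihilator ↥(loc O (Algebra.adjoin k ({algebraMap (MvPolynomial (Fin 3) k) K (X 0),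
        algebraMap (MvPolynomial (Fin 3) k) K (X 1), algebraMap (MvPolynomial (Fin 3) k) K (X 2),
        (algebraMap (MvPolynomial (Fin 3) k) K (X 1) ^ 3 + algebraMap (MvPolynomial (Fin 3) k) K (X 2) ^ 4) *
          (algebraMap (MvPolynomial (Fin 3) k) K (X 0))⁻¹} : Set K))) := by
  rw [mem_cohomologyAnnihilator_iff] at h ⊢
  obtain ⟨n, hn⟩ := h
  exact ⟨n, mem_cohomologyAnnihilatorOfDegree_loc_of_affine k K O hk hx hy hz ht hn hb⟩

/-- **AFFINE → `T₀`, route's set-valued form**: `b̄ ∈ ca(k[x,y,z,t]/(xy − z³ − t⁴)) ⇒ b(x,y,z,t) ∈ NoZeno.Birth.ca (loc O A)`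
(the element automatically lies in `A ≤ loc O A`). [cite: IyengarTakahashi2014, Lemma 2.10 (1)] -/
theorem mem_ca_loc_of_affine (O : ValuationSubring K) (hk : ∀ c : k, algebraMap k K c ∈ O)
    (hx : O.valuation (algebraMap (MvPolynomial (Fin 3) k) K (X 0)) < 1)
    (hy : O.valuation ((algebraMap (MvPolynomial (Fin 3) k) K (X 1) ^ 3 + algebraMap (MvPolynomial (Fin 3) k) K (X 2) ^ 4) *
      (algebraMap (MvPolynomial (Fin 3) k) K (X 0))⁻¹) < 1)
    (hz : O.valuation (algebraMap (MvPolynomial (Fin 3) k) K (X 1)) < 1)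
    (ht : O.valuation (algebraMap (MvPolynomial (Fin 3) k) K (X 2)) < 1)
    {b : MvPolynomial (Fin 4) k}
    (h : Ideal.Quotient.mk (Ideal.span ({X 0 * X 1 - X 2 ^ 3 - X 3 ^ 4} : Set (MvPolynomial (Fin 4) k))) b ∈
      cohomologyAnnihilator (MvPolynomial (Fin 4) k ⧸
        Ideal.span ({X 0 * X 1 - X 2 ^ 3 - X 3 ^ 4} : Set (MvPolynomial (Fin 4) k)))) :
    MvPolynomial.aeval (R := k)
        (![algebraMap (MvPolynomial (Fin 3) k) K (X 0),
          (algebraMap (MvPolynomial (Fin 3) k) K (X 1) ^ 3 + algebraMap (MvPolynomial (Fin 3) k) K (X 2) ^ 4) *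
            (algebraMap (MvPolynomial (Fin 3) k) K (X 0))⁻¹,
          algebraMap (MvPolynomial (Fin 3) k) K (X 1), algebraMap (MvPolynomial (Fin 3) k) K (X 2)] : Fin 4 → K) b ∈
      NoZeno.Birth.ca (loc O (Algebra.adjoin k ({algebraMap (MvPolynomial (Fin 3) k) K (X 0),
        algebraMap (MvPolynomial (Fin 3) k) K (X 1), algebraMap (MvPolynomial (Fin 3) k) K (X 2),
        (algebraMap (MvPolynomial (Fin 3) k) K (X 1) ^ 3 + algebraMap (MvPolynomial (Fin 3) k) K (X 2) ^ 4) *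
          (algebraMap (MvPolynomial (Fin 3) k) K (X 0))⁻¹} : Set K))) := by
  set A : Subalgebra k K := Algebra.adjoin k ({algebraMap (MvPolynomial (Fin 3) k) K (X 0),
      algebraMap (MvPolynomial (Fin 3) k) K (X 1), algebraMap (MvPolynomial (Fin 3) k) K (X 2),
      (algebraMap (MvPolynomial (Fin 3) k) K (X 1) ^ 3 + algebraMap (MvPolynomial (Fin 3) k) K (X 2) ^ 4) *
        (algebraMap (MvPolynomial (Fin 3) k) K (X 0))⁻¹} : Set K) with hA
  have hbA : MvPolynomial.aeval (R := k)
      (![algebraMap (MvPolynomial (Fin 3) k) K (X 0),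
        (algebraMap (MvPolynomial (Fin 3) k) K (X 1) ^ 3 + algebraMap (MvPolynomial (Fin 3) k) K (X 2) ^ 4) *
          (algebraMap (MvPolynomial (Fin 3) k) K (X 0))⁻¹,
        algebraMap (MvPolynomial (Fin 3) k) K (X 1), algebraMap (MvPolynomial (Fin 3) k) K (X 2)] : Fin 4 → K) b ∈ A := by
    rw [hA, ← range_aeval_kc3 k K]
    exact (AlgHom.mem_range _).mpr ⟨b, rfl⟩
  have hb := mem_loc_of_mem O A hbA
  have hu := mem_cohomologyAnnihilator_loc_of_affine k K O hk hx hy hz ht h hb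
  have hbr := Subalgebra.image_coe_cohomologyAnnihilator (loc O A)
  have hmem := Set.mem_image_of_mem ((↑) : ↥(loc O A) → K) hu
  rw [hbr] at hmem
  exact hmem

end KC3

end Summit.ResolutionOfSingularities.ResolutionOfSingularities.Theorems.HomologicalConductor.KC3Upper

end
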